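import Mathlib
import Summits.Ventures.HodgeRepro.Tier4.Line4.NonsplitLocal
import Summits.Ventures.HodgeRepro.Tier4.Line4.ScaledBox
import Summits.Ventures.HodgeRepro.Tier4.Line4.OrbitProper
import Summits.Ventures.HodgeRepro.Tier4.Line4.CentreFinSeesaw
import Summits.Ventures.HodgeRepro.Tier4.Line4.ZDomainSplit

/-!
# Tier4/Line4/CentreAwayFinite — C-L4-NONSPLIT-FINITE: the rational centre meets the level-one subgroup of the AWAY torus
`T_f^{(p)}` in a FINITE set when no place of `k` above `p` splits in `E′`; hence `centreAway` is DISCRETE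

Blind re-derivation cell `pub-hodge-repro`, Tier 4 «prove the step» (README §9–§10), seat t4-L1-p2 (prover, LINE L1, gen 5;
L4 service cut C-L4-NONSPLIT-FINITE, plan-4 g6 S15721 / ruling (E1) S15715, TAKEN S15722, statement S15764).  Tree path
`lean/Summits/Ventures/HodgeRepro/Tier4/Line4/CentreAwayFinite.lean`.  Paper note proofs/t4/L4/NONSPLIT-FINITE-t4-L1-p2.md.  Imports
`Line4/NonsplitLocal` (the local half), `Line4/ScaledBox` (the compact box), L2-p3's `Line4/OrbitProper` (`exists_torus_data`), L2-p2's
`Line4/CentreFinSeesaw` (`T_∞` compact, the proper projection), L2-p1's `Line4/ZDomainSplit` (`centreAway`, `awayTfHom`, the split and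
the level).  The row-plane instances are `Line4/CentreAwayFiniteRow`.  No literature.

THE STATEMENT.  `W` a plane with the torus-data property `HasTorusData W d` (the genuine row planes, `d = n`), `S = placesAbove k p`,
`centreAway W S = (centreFin W).map awayTfHom` the image of `Z(k)` in `T_f^{(S)}`, `levelAwayOne W S = {y ∈ T_f^{(S)} | y ∈ K(1)}`.
**`finite_centreAway_inter_levelAwayOne`**: under the DISPLAYED `hns : ∀ v ∈ S, ¬ IsSquare (−d)` in `k_v` («no place above `p`
splits in `E′ = k(√−d)`», plan-4's form at `t = 0`) and `T_∞` compact, `centreAway W S ∩ levelAwayOne W S` is finite;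
**`discreteTopology_centreAway`**: `centreAway W S` is discrete.  `hns` is load-bearing: at a split place the
norm-one `p`-units are unbounded (crit-2 Entry 338).

THE PROOF.  (a) A torus element `z ∈ T_f` is `esc x₀ y₀ P₀ + esc x₁ y₁ P₁` with adelic norm-one scalars (`exists_torus_data`);
at `v ∈ S` the components lie on the norm-one curve of `k_v`, so `p^m x_{i,v}, p^m y_{i,v} ∈ 𝓞_v` (NonsplitLocal) and the entries
`x_i c + y_i c′` are integral after one more factor `p^{m₀}` (ScaledBox's `exists_pow_mul_entries_mem`).  (b) Off `S`, `awayTf z ∈ K(1)`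
is entrywise integrality and `p` is a `v`-unit.  (c) So `mat z`, `mat z⁻¹` lie in the compact `scaledBox (p^M)` (`S` finite), and
`centreFin ∩ {b | mat b, mat b⁻¹ ∈ box}` is finite (CentreFinSeesaw's proper projection, L2-p3's `isCompact_setOf_mat_mem`);
`centreAway ∩ levelAwayOne` is its image under `awayTfHom`.  (d) `levelAwayOne` is an open neighbourhood of `1`: discreteness.

Nothing here says anything about the status of the Hodge conjecture for CM abelian varieties, which is NOT proved
(HC_CM is NOT proved by anyone in this repository).
-/

set_option autoImplicit false

noncomputable section

namespace Summit.Ventures.HodgeRepro.Tier4.Line4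

open Summit.Ventures.HodgeRepro.Tier4 Summit.Ventures.HodgeRepro.Tier4.Common Summit.Ventures.HodgeRepro.Tier4.Line1
  NumberField IsDedekindDomain Matrix

open scoped NumberField Classical

/-! ## Part A — the entries of a torus element through its line scalars -/

section Entries

variable {k : Type} [Field k] [NumberField k] (W : PlaneData k)

/-- The entries of `esc x y · adMat A`: `x · A_{ij} + y · (Ω A)_{ij}`. -/
theorem esc_mul_adMat_apply (x y : Ad k) (A : Matrix (Fin 4) (Fin 4) k) (i j : Fin 4) :
    (esc W x y * adMat k A) i j =
      x * algebraMap k (Ad k) (A i j) + y * algebraMap k (Ad k) ((W.Ω * A) i j) := by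
  rw [esc, add_mul, smul_mul_assoc, one_mul, smul_mul_assoc, ← adMat_mul, Matrix.add_apply, Matrix.smul_apply,
    Matrix.smul_apply, smul_eq_mul, smul_eq_mul]
  rfl

/-- The `v`-component of an entry of a decomposed matrix. -/
theorem adComponentFin_entry_of_decomp {x y : Fin 2 → Ad k} {M : M4 k}
    (hM : M = esc W (x 0) (y 0) * adMat k (W.P 0) + esc W (x 1) (y 1) * adMat k (W.P 1))
    (v : HeightOneSpectrum (𝓞 k)) (i j : Fin 4) :
    adComponentFin k v (M i j) =
      adComponentFin k v (x 0) * algebraMap k (v.adicCompletion k) (W.P 0 i j) +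
      adComponentFin k v (y 0) * algebraMap k (v.adicCompletion k) ((W.Ω * W.P 0) i j) +
      (adComponentFin k v (x 1) * algebraMap k (v.adicCompletion k) (W.P 1 i j) +
      adComponentFin k v (y 1) * algebraMap k (v.adicCompletion k) ((W.Ω * W.P 1) i j)) := by
  rw [hM, Matrix.add_apply, esc_mul_adMat_apply, esc_mul_adMat_apply, map_add, map_add, map_add, map_mul, map_mul,
    map_mul, map_mul, adComponentFin_algebraMap, adComponentFin_algebraMap, adComponentFin_algebraMap,
    adComponentFin_algebraMap]

end Entries

/-! ## Part B — the row plane's torus data, and THE LOCAL BOUND at `v ∣ p` -/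

section Bound

variable {k : Type} [Field k] [NumberField k]

/-- The coercion `k → k_v` is the algebra map. -/
theorem coe_eq_algebraMap_adicCompletion (v : HeightOneSpectrum (𝓞 k)) (c : k) :
    ((c : k) : v.adicCompletion k) = algebraMap k (v.adicCompletion k) c := rfl

/-- `p ∈ 𝓞_v` for every finite place (`|p|_v ≤ 1`). -/
theorem natCast_mem_adicCompletionIntegers (v : HeightOneSpectrum (𝓞 k)) (p : ℕ) :
    algebraMap k (v.adicCompletion k) (p : k) ∈ v.adicCompletionIntegers k := by
  rw [HeightOneSpectrum.mem_adicCompletionIntegers, ← coe_eq_algebraMap_adicCompletion]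
  exact natSize_le_one k v p

/-- Monotonicity of the integral bound in the exponent: `p^m x ∈ 𝓞_v → p^{m'} x ∈ 𝓞_v` for `m ≤ m'`. -/
theorem pow_mul_mem_of_le (v : HeightOneSpectrum (𝓞 k)) (p : ℕ) {x : v.adicCompletion k} {m m' : ℕ} (h : m ≤ m')
    (hx : algebraMap k (v.adicCompletion k) (p : k) ^ m * x ∈ v.adicCompletionIntegers k) :
    algebraMap k (v.adicCompletion k) (p : k) ^ m' * x ∈ v.adicCompletionIntegers k := by
  obtain ⟨n, rfl⟩ := Nat.exists_eq_add_of_le h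
  rw [pow_add, mul_comm (_ ^ m), mul_assoc]
  exact mul_mem (pow_mem (natCast_mem_adicCompletionIntegers v p) n) hx

/-- `|p|_v < 1` in the norm, at a place above `p`. -/
theorem norm_natCast_lt_one_of_mem_placesAbove {p : ℕ} {v : HeightOneSpectrum (𝓞 k)} (hv : v ∈ placesAbove (k := k) p) :
    ‖((p : k) : v.adicCompletion k)‖ < 1 := by
  rw [Valued.toNormedField.norm_lt_one_iff]
  exact (natSize_lt_one_iff_mem v p).2 hv

/-- The places above `p` are finitely many (`p ≠ 0`). -/
theorem finite_placesAbove {p : ℕ} (hp : p ≠ 0) : (placesAbove (k := k) p).Finite :=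
  (finite_natSize_lt_one (k := k) hp).subset fun v hv => (natSize_lt_one_iff_mem v p).2 hv

/-- The `v`-component of a norm-one adelic scalar lies on the norm-one curve of `k_v`. -/
theorem sq_add_mul_sq_eq_one_of_nrm {d : k} {x y : Ad k} (h : nrm d x y = 1) (v : HeightOneSpectrum (𝓞 k)) :
    adComponentFin k v x ^ 2 + algebraMap k (v.adicCompletion k) d * adComponentFin k v y ^ 2 = 1 := by
  have := congrArg (adComponentFin k v) h
  rw [nrm, map_add, map_mul, map_mul, map_mul, adComponentFin_algebraMap, map_one] at this
  rw [← this]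
  ring

/-- **The torus-data property of a plane**: every element of `T` is `esc x₀ y₀ P₀ + esc x₁ y₁ P₁` with norm-one line scalars
(`x_i² + d y_i² = 1`); a theorem for the genuine row planes (`hasTorusData_ofLinesRow`, CentreAwayFiniteRow). -/
def HasTorusData (W : PlaneData k) (d : k) : Prop :=
  ∀ g : GA W, g ∈ torusT W → ∃ x y : Fin 2 → Ad k,
    GA.mat W g = esc W (x 0) (y 0) * adMat k (W.P 0) + esc W (x 1) (y 1) * adMat k (W.P 1) ∧ ∀ i, nrm d (x i) (y i) = 1

/-- **THE LOCAL BOUND AT `v ∣ p`**: one exponent `m` such that for every torus element `g` and every `m' ≥ m`,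
`p^{m'} · (mat g)_{ij,v} ∈ 𝓞_v` (`−d` not a square in `k_v`). -/
theorem exists_pow_mul_entries_mem_of_mem_placesAbove (W : PlaneData k) {d : k} (hdata : HasTorusData W d)
    {p : ℕ} {v : HeightOneSpectrum (𝓞 k)} (hv : v ∈ placesAbove (k := k) p)
    (hns : ¬ IsSquare (-(algebraMap k (v.adicCompletion k) d))) :
    ∃ m : ℕ, ∀ m' : ℕ, m ≤ m' → ∀ g : GA W, g ∈ torusT W →
      ∀ i j : Fin 4, algebraMap k (v.adicCompletion k) (p : k) ^ m' *
        adComponentFin k v (GA.mat W g i j) ∈ v.adicCompletionIntegers k := by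
  have hpv := norm_natCast_lt_one_of_mem_placesAbove hv
  obtain ⟨m₁, hm₁⟩ := exists_pow_mul_mem_adicCompletionIntegers_of_sq_add_mul_sq_eq_one v hns hpv
  obtain ⟨m₂, hm₂⟩ := exists_pow_mul_entries_mem v hpv ![W.P 0, W.Ω * W.P 0, W.P 1, W.Ω * W.P 1]
  refine ⟨m₁ + m₂, fun m' hm' g hg i j => ?_⟩
  obtain ⟨x, y, hxy, hnrm⟩ := hdata g hg
  rw [adComponentFin_entry_of_decomp W hxy v i j]
  have hx : ∀ l : Fin 2, algebraMap k (v.adicCompletion k) (p : k) ^ m₁ * adComponentFin k v (x l) ∈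
      v.adicCompletionIntegers k := fun l =>
    (hm₁ _ _ (sq_add_mul_sq_eq_one_of_nrm (hnrm l) v)).1
  have hy : ∀ l : Fin 2, algebraMap k (v.adicCompletion k) (p : k) ^ m₁ * adComponentFin k v (y l) ∈
      v.adicCompletionIntegers k := fun l =>
    (hm₁ _ _ (sq_add_mul_sq_eq_one_of_nrm (hnrm l) v)).2
  have hc : ∀ l : Fin 4, algebraMap k (v.adicCompletion k) (p : k) ^ m₂ * algebraMap k (v.adicCompletion k)
      (![W.P 0, W.Ω * W.P 0, W.P 1, W.Ω * W.P 1] l i j) ∈ v.adicCompletionIntegers k := fun l => hm₂ l i j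
  have h0 := hc 0; have h1 := hc 1; have h2 := hc 2; have h3 := hc 3
  simp only [Matrix.cons_val_zero, Matrix.cons_val_one, Matrix.cons_val_two, Matrix.cons_val_three] at h0 h1 h2 h3
  set P := algebraMap k (v.adicCompletion k) (p : k) with hP
  have key : P ^ (m₁ + m₂) *
      (adComponentFin k v (x 0) * algebraMap k (v.adicCompletion k) (W.P 0 i j) +
        adComponentFin k v (y 0) * algebraMap k (v.adicCompletion k) ((W.Ω * W.P 0) i j) +
        (adComponentFin k v (x 1) * algebraMap k (v.adicCompletion k) (W.P 1 i j) +
        adComponentFin k v (y 1) * algebraMap k (v.adicCompletion k) ((W.Ω * W.P 1) i j))) =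
      (P ^ m₁ * adComponentFin k v (x 0)) * (P ^ m₂ * algebraMap k (v.adicCompletion k) (W.P 0 i j)) +
      (P ^ m₁ * adComponentFin k v (y 0)) * (P ^ m₂ * algebraMap k (v.adicCompletion k) ((W.Ω * W.P 0) i j)) +
      ((P ^ m₁ * adComponentFin k v (x 1)) * (P ^ m₂ * algebraMap k (v.adicCompletion k) (W.P 1 i j)) +
      (P ^ m₁ * adComponentFin k v (y 1)) * (P ^ m₂ * algebraMap k (v.adicCompletion k) ((W.Ω * W.P 1) i j))) := by
    rw [pow_add]
    ring
  apply pow_mul_mem_of_le v p hm'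
  rw [key]
  exact add_mem (add_mem (mul_mem (hx 0) h0) (mul_mem (hy 0) h1)) (add_mem (mul_mem (hx 1) h2) (mul_mem (hy 1) h3))

end Bound

/-! ## Part C — the global bound, the compact set in `T_f`, and THE FINITENESS -/

section Global

variable {k : Type} [Field k] [NumberField k]

/-- **The level-one subgroup of the away torus**, as a set: the elements of `T_f^{(S)}` lying in `K(1)`. -/
def levelAwayOne (W : PlaneData k) (S : Set (HeightOneSpectrum (𝓞 k))) : Set (torusFinAway W S) :=
  {y | finInc W (y : torusFin W) ∈ levelK W 1}

/-- `1 ∈ levelAwayOne`. -/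
theorem one_mem_levelAwayOne (W : PlaneData k) (S : Set (HeightOneSpectrum (𝓞 k))) : (1 : torusFinAway W S) ∈ levelAwayOne W S := by
  show finInc W ((1 : torusFinAway W S) : torusFin W) ∈ levelK W 1
  rw [Subgroup.coe_one, map_one]
  exact (levelK W 1).one_mem

/-- The inclusion `T_f^{(S)} → G(𝔸_f)` is continuous. -/
theorem continuous_torusFinAway_to_finitePart (W : PlaneData k) (S : Set (HeightOneSpectrum (𝓞 k))) :
    Continuous (fun y : torusFinAway W S => (⟨finInc W (y : torusFin W), coe_coe_mem_finitePart W (y : torusFin W)⟩ : finitePart W)) :=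
  Continuous.subtype_mk (continuous_subtype_val.comp (continuous_subtype_val.comp continuous_subtype_val)) _

/-- `levelAwayOne` is open in `T_f^{(S)}` (the preimage of the open `K(1) ≤ G(𝔸_f)`). -/
theorem isOpen_levelAwayOne (W : PlaneData k) (S : Set (HeightOneSpectrum (𝓞 k))) : IsOpen (levelAwayOne W S) :=
  (isCompactOpenIn_levelK W one_ne_zero).isOpen.preimage (continuous_torusFinAway_to_finitePart W S)

/-- The `w`-component of an entry of `finM`. -/
theorem finM_apply_apply_eq_adComponentFin (M : M4 k) (i j : Fin 4) (w : HeightOneSpectrum (𝓞 k)) :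
    (finM k M i j) w = adComponentFin k w (M i j) := rfl

/-- `|1_{ij}|_w ≤ 1`. -/
theorem valued_one_apply_le_one (i j : Fin 4) (w : HeightOneSpectrum (𝓞 k)) :
    Valued.v (((1 : M4f k) i j) w) ≤ 1 := by
  by_cases hij : i = j
  · subst hij
    rw [Matrix.one_apply_eq, fa_one_apply, map_one]
  · rw [Matrix.one_apply_ne hij, fa_zero_apply, map_zero]
    exact zero_le_one

/-- **Integrality off `S` from the away level**: if `awayTf z ∈ K(1)`, the entries of `z` at every `w ∉ S` are integral. -/
theorem adComponentFin_mem_of_awayTf_mem_levelK {W : PlaneData k} {S : Set (HeightOneSpectrum (𝓞 k))} {z : torusFin W}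
    (hz : finInc W (awayTf W S z : torusFin W) ∈ levelK W 1) {w : HeightOneSpectrum (𝓞 k)} (hw : w ∉ S) (i j : Fin 4) :
    adComponentFin k w (GA.mat W (finInc W z) i j) ∈ w.adicCompletionIntegers k := by
  have hfin : finInc W (awayTf W S z : torusFin W) ∈ finitePart W := by
    rw [finInc_apply]
    exact coe_coe_mem_finitePart W _
  have h := ((mem_levelK_iff_forall W hfin 1).1 hz).1 i j w
  have hcoe : finInc W (awayTf W S z : torusFin W) = GA.offPlacesPart W S (finInc W z) := rfl
  rw [hcoe, finM_offPlacesPart_sub_one_apply, if_neg hw, fa_sub_apply] at h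
  have h1 : natSize k w 1 = 1 := by
    unfold natSize
    simp
  rw [h1, finM_apply_apply_eq_adComponentFin] at h
  rw [HeightOneSpectrum.mem_adicCompletionIntegers]
  have hsplit : adComponentFin k w (GA.mat W (finInc W z) i j) =
      (adComponentFin k w (GA.mat W (finInc W z) i j) - ((1 : M4f k) i j) w) + ((1 : M4f k) i j) w := by ring
  rw [hsplit]
  exact (Valuation.map_add _ _ _).trans (max_le h (valued_one_apply_le_one i j w))

/-- Box membership of `mat z` from the placewise integrality of its scaled entries. -/
theorem mat_finInc_mem_scaledBox {W : PlaneData k} (z : torusFin W) (c : k)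
    (h : ∀ (i j : Fin 4) (w : HeightOneSpectrum (𝓞 k)),
      algebraMap k (w.adicCompletion k) c * adComponentFin k w (GA.mat W (finInc W z) i j) ∈ w.adicCompletionIntegers k) :
    GA.mat W (finInc W z) ∈ scaledBox k c := by
  have hfin : finInc W z ∈ finitePart W := by
    rw [finInc_apply]
    exact coe_coe_mem_finitePart W z
  exact mem_scaledBox_of k ((mem_finitePart_iff_infM W (finInc W z)).1 hfin) fun i j =>
    (finPart_mem_scaledIntegral_iff k c _).2 (h i j)

/-- `finInc z ∈ T`. -/
theorem finInc_mem_torusT {W : PlaneData k} (z : torusFin W) : finInc W z ∈ torusT W := by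
  rw [finInc_apply]
  exact (z : torusT W).2

/-- **THE GLOBAL BOUND**: one exponent `M` such that every `z ∈ T_f` with `awayTf z ∈ K(1)` has `mat z ∈ scaledBox (p^M)`. -/
theorem exists_pow_mat_mem_scaledBox (W : PlaneData k) {d : k} (hdata : HasTorusData W d) {p : ℕ} (hp : p ≠ 0)
    (hns : ∀ v ∈ placesAbove (k := k) p, ¬ IsSquare (-(algebraMap k (v.adicCompletion k) d))) :
    ∃ M : ℕ, ∀ z : torusFin W, finInc W (awayTf W (placesAbove p) z : torusFin W) ∈ levelK W 1 →
      GA.mat W (finInc W z) ∈ scaledBox k ((p : k) ^ M) := by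
  have hSfin := finite_placesAbove (k := k) hp
  have hloc : ∀ v : HeightOneSpectrum (𝓞 k), ∃ m : ℕ, v ∈ placesAbove (k := k) p →
      ∀ m' : ℕ, m ≤ m' → ∀ g : GA W, g ∈ torusT W →
      ∀ i j : Fin 4, algebraMap k (v.adicCompletion k) (p : k) ^ m' *
        adComponentFin k v (GA.mat W g i j) ∈ v.adicCompletionIntegers k := by
    intro v
    by_cases hv : v ∈ placesAbove (k := k) p
    · obtain ⟨m, hm⟩ := exists_pow_mul_entries_mem_of_mem_placesAbove W hdata hv (hns v hv)
      exact ⟨m, fun _ => hm⟩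
    · exact ⟨0, fun h => absurd h hv⟩
  choose m hm using hloc
  refine ⟨hSfin.toFinset.sup m, fun z hz => ?_⟩
  refine mat_finInc_mem_scaledBox z _ fun i j w => ?_
  rw [map_pow]
  by_cases hw : w ∈ placesAbove (k := k) p
  · exact hm w hw _ (Finset.le_sup (hSfin.mem_toFinset.2 hw)) _ (finInc_mem_torusT z) i j
  · exact mul_mem (pow_mem (natCast_mem_adicCompletionIntegers w p) _) (adComponentFin_mem_of_awayTf_mem_levelK hz hw i j)

/-- `T_f ↪ G(𝔸)` is a closed embedding. -/
theorem isClosedEmbedding_finInc (W : PlaneData k) : Topology.IsClosedEmbedding (finInc W) := by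
  have h1 : Topology.IsClosedEmbedding (Subtype.val : torusT W → GA W) :=
    (Common.isClosed_torusT W).isClosedEmbedding_subtypeVal
  have h2 : IsClosed (torusFin W : Set (torusT W)) := by
    have : (torusFin W : Set (torusT W)) = Subtype.val ⁻¹' (finitePart W : Set (GA W)) := by
      ext x
      rfl
    rw [this]
    exact (isClosed_finitePart W).preimage continuous_subtype_val
  exact h1.comp h2.isClosedEmbedding_subtypeVal

/-- **The box set is compact in `T_f`**: `{z | mat z, mat z⁻¹ ∈ scaledBox c}`. -/
theorem isCompact_setOf_mat_mem_scaledBox (W : PlaneData k) {c : k} (hc : c ≠ 0) :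
    IsCompact {z : torusFin W | GA.mat W (finInc W z) ∈ scaledBox k c ∧ GA.mat W (finInc W z)⁻¹ ∈ scaledBox k c} := by
  have h : {z : torusFin W | GA.mat W (finInc W z) ∈ scaledBox k c ∧ GA.mat W (finInc W z)⁻¹ ∈ scaledBox k c} =
      finInc W ⁻¹' {g : GA W | GA.mat W g ∈ scaledBox k c ∧ GA.mat W g⁻¹ ∈ scaledBox k c} := rfl
  rw [h]
  exact (isClosedEmbedding_finInc W).isCompact_preimage
    (isCompact_setOf_mat_mem W (isCompact_scaledBox k hc) (isCompact_scaledBox k hc))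

/-- **`Z(k)` meets the box set in a finite set** when `T_∞` is compact (CentreFinSeesaw's proper projection). -/
theorem finite_centreFin_inter_setOf_mat_mem_scaledBox (W : PlaneData k) [CompactSpace (torusInf W)] {c : k} (hc : c ≠ 0) :
    ((centreFin W : Set (torusFin W)) ∩
      {z : torusFin W | GA.mat W (finInc W z) ∈ scaledBox k c ∧ GA.mat W (finInc W z)⁻¹ ∈ scaledBox k c}).Finite := by
  haveI := discreteTopology_rationalCentreT W
  haveI : T2Space (torusFin W) := t2Space_torusFin W
  exact Common.finite_map_inter_of_isCompact_preimage (rationalCentreT W) (finTfHom W)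
    (isCompact_preimage_finTfHom W (isCompact_setOf_mat_mem_scaledBox W hc))

/-- **C-L4-NONSPLIT-FINITE, general form**: for a plane with the torus-data property and compact `T_∞`, when `−d` is not a
square at any place of `k` above `p` (`hns`), the image of the rational centre in the away torus `T_f^{(p)}` meets the level-one
subgroup in a FINITE set. -/
theorem finite_centreAway_inter_levelAwayOne (W : PlaneData k) [CompactSpace (torusInf W)] {d : k} (hdata : HasTorusData W d)
    {p : ℕ} (hp : p ≠ 0) (hns : ∀ v ∈ placesAbove (k := k) p, ¬ IsSquare (-(algebraMap k (v.adicCompletion k) d))) :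
    ((centreAway W (placesAbove p) : Set (torusFinAway W (placesAbove p))) ∩ levelAwayOne W (placesAbove p)).Finite := by
  obtain ⟨M, hM⟩ := exists_pow_mat_mem_scaledBox W hdata hp hns
  have hfin := finite_centreFin_inter_setOf_mat_mem_scaledBox W (pow_ne_zero M (Nat.cast_ne_zero.2 hp))
  refine (hfin.image (awayTfHom W (placesAbove p))).subset ?_
  intro y hy
  obtain ⟨hy1, hy2⟩ := hy
  obtain ⟨z, hz, rfl⟩ := Subgroup.mem_map.1 hy1
  refine ⟨z, ⟨hz, hM z hy2, ?_⟩, rfl⟩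
  have hinv : finInc W z⁻¹ = (finInc W z)⁻¹ := rfl
  have hy' : finInc W (awayTf W (placesAbove p) z⁻¹ : torusFin W) ∈ levelK W 1 := by
    have h2 : finInc W (awayTf W (placesAbove p) z⁻¹ : torusFin W) =
        (finInc W (awayTf W (placesAbove p) z : torusFin W))⁻¹ := by
      show GA.offPlacesPart W (placesAbove p) (finInc W z⁻¹) = (GA.offPlacesPart W (placesAbove p) (finInc W z))⁻¹
      rw [hinv, offPlacesPart_inv]
    rw [h2]
    exact inv_mem hy2
  have := hM z⁻¹ hy'
  rwa [hinv] at this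

/-- **`centreAway` is DISCRETE** in `T_f^{(p)}` (it meets the open neighbourhood `levelAwayOne` of `1` in a finite set). -/
theorem discreteTopology_centreAway (W : PlaneData k) [CompactSpace (torusInf W)] {d : k} (hdata : HasTorusData W d)
    {p : ℕ} (hp : p ≠ 0) (hns : ∀ v ∈ placesAbove (k := k) p, ¬ IsSquare (-(algebraMap k (v.adicCompletion k) d))) :
    DiscreteTopology (centreAway W (placesAbove p)) := by
  have hfin := finite_centreAway_inter_levelAwayOne W hdata hp hns
  haveI : T2Space (torusFin W) := t2Space_torusFin W
  rw [discreteTopology_iff_isOpen_singleton_one]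
  set F : Set (torusFinAway W (placesAbove p)) :=
    ((centreAway W (placesAbove p) : Set _) ∩ levelAwayOne W (placesAbove p)) \ {1} with hF
  have hFfin : F.Finite := hfin.sdiff
  have hVo : IsOpen (levelAwayOne W (placesAbove p) \ F) := (isOpen_levelAwayOne _ _).sdiff hFfin.isClosed
  rw [isOpen_induced_iff]
  refine ⟨levelAwayOne W (placesAbove p) \ F, hVo, ?_⟩
  ext x
  simp only [Set.mem_preimage, Set.mem_singleton_iff, Set.mem_sdiff, SetLike.mem_coe, hF, Set.mem_inter_iff,
    not_and, not_not]
  constructor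
  · rintro ⟨hxK, hx⟩
    exact Subtype.ext (hx ⟨x.2, hxK⟩)
  · rintro rfl
    exact ⟨one_mem_levelAwayOne _ _, fun _ => rfl⟩

end Global

end Summit.Ventures.HodgeRepro.Tier4.Line4

end
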